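import Summits.MatrixMultiplication.MatrixMultiplication.Theorems.AbelianSTPPCensusTB5StatDefs

/-!
# T_B static certificate, range `5995 … 6012` (t*-indexed linear checker with the k-member tree at `τ = 2375/1000`): kernel evaluation, the shape checks of the tree-heavy volumes `3570` on single orders / order sub-ranges (one theorem per (volume, sub-range): bounded kernel memory)

Cell mm-stpp (rung F-M1), tier T_B = «beat `2.375` (Coppersmith–Winograd)»; checker in `AbelianSTPPCensusTB5StatDefs.lean`, table and bucket lists in `AbelianSTPPCensusTB5StatData.lean`
(pattern: theory g12's `AbelianSTPPCensusTAStatDDom*/DCk*.lean`).  `decide` with kernel reduction (standard axioms; no `native_decide`), `Elab.async false`;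
consumed by `TB5Stat.checkV_sound` / `TB5Stat.domV_sound` / `TB5Stat.m2V_sound` in the leaf `AbelianSTPPCensusLeafTB6012Closed.lean`.
WHAT THIS IS NOT: arithmetic on shape lists only; no statement about STPP families or `ω`.
-/

set_option linter.dupNamespace false
set_option autoImplicit false
set_option Elab.async false

namespace Summit.MatrixMultiplication.MatrixMultiplication.Theorems.TB5Stat

set_option maxHeartbeats 0 in
/-- Heavy volume `3570` (40 shapes; 489570 tree nodes over all orders), orders `6011 … 6011`: every sorted candidate shape passes `checkShape 6011 6011`. [original] -/
theorem ck3570r16 : TB5Stat.checkV 6011 6011 1 3570 = true := by decide +kernel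

set_option maxHeartbeats 0 in
/-- Heavy volume `3570` (40 shapes; 489570 tree nodes over all orders), orders `6012 … 6012`: every sorted candidate shape passes `checkShape 6012 6012`. [original] -/
theorem ck3570r17 : TB5Stat.checkV 6012 6012 1 3570 = true := by decide +kernel

set_option maxHeartbeats 0 in
/-- Heavy volume `3584` (29 shapes; 5225206 tree nodes over all orders), orders `5995 … 5995`: every sorted candidate shape passes `checkShape 5995 5995`. [original] -/
theorem ck3584r0 : TB5Stat.checkV 5995 5995 1 3584 = true := by decide +kernel

set_option maxHeartbeats 0 in
/-- Heavy volume `3584` (29 shapes; 5225206 tree nodes over all orders), orders `5996 … 5996`: every sorted candidate shape passes `checkShape 5996 5996`. [original] -/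
theorem ck3584r1 : TB5Stat.checkV 5996 5996 1 3584 = true := by decide +kernel

end Summit.MatrixMultiplication.MatrixMultiplication.Theorems.TB5Stat
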